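import Mathlib
import Literature.Analysis.Matrix.HadamardInequality
import Literature.NumberTheory.DiophantineApproximation.VandermondeDiscrepancy
import Literature.NumberTheory.MahlerMeasure.IntegerMahlerMeasure
import Literature.NumberTheory.MahlerMeasure.SmallMeasureStructure
import Literature.NumberTheory.MahlerMeasure.CyclotomicIntegerHeightBound
import HarnessLib

/-!
# Kronecker's Second Theorem, Gonçalves' Inequality, the Liouville–Mahler inequality and the Vandermonde product bound (McKee–Smyth Thm 1.4, Prop. 1.12, Thm 1.21, Lemma 3.7) — re-homed proofs

**Classical inequalities around the Mahler measure** (McKee–Smyth, *Around the Unit Circle*, Chapter 1 and Lemma 3.7): Kronecker's Second Theorem (Thm 1.4 p.21, Kronecker 1857: a monic `P ∈ ℤ[X]` all of whose complex roots are real and in `[−2, 2]` has every root of the form `β + β⁻¹` with `β` a root of unity — via the reciprocal lift `x^d P(x + 1/x)`, the file's one definition `traceLift`, and Kronecker's First Theorem from Mathlib); Gonçalves' Inequality (Prop. 1.12 p.24: `M(P)² + a₀² a_d² / M(P)² ≤ Σ a_j²`, real and integer forms); the Liouville-type inequality Thm 1.21 p.25 (`Q(α) = 0` or `|Q(α)|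 ≥ max(1,|α|)^e /(L(Q)^{d−1} M(α)^e)`, via the resultant); and the Vandermonde product bound of Lemma 3.7 p.65 (`∏_{i≠j} |zᵢ − zⱼ| ≤ d^d · M(z)^{2(d−1)}`, via the tree's Hadamard inequality `Literature.Analysis.Matrix.norm_det_sq_le_of_entry_le` and `vandermondeAbs`) — RE-HOMED into `Literature/` by the Hodge foundations lane (`lit-hodgefound`, seat p20, generation 36) from the venture cell `pub-namedobj` (seat `pub-namedobj-mahler`): verbatim DECLARATION-LEVEL ports, in dependency order and each with its original module docstring, of `Summits/Ventures/DiscreteObjects/Mahler/{KroneckerTwoCos (all 4: 1 def + 3 theorems), GoncalvesInequality (all 9), VandermondeProductBound (all 3), DobrowolskiLemma (2), LiouvilleInequality (all 2)}.lean`, namespace `Summit.Ventures.DiscreteObjects.Mahler` re-rooted as `Literature.NumberTheory.MahlerMeasure` (this file's path namespace).  Theorems only unless said otherwise; imports Mathlib/Literature only; every declaration carries the citation of the printed statement it formalises; declarations the cone shares with earlier ports (`IntegerMahlerMeasure`, `SmythNonreciprocalTheorem`, `SmythIsolation`, `SmallMeasureStructure`, `CyclotomicIntegerHeightBound`, `DobrowolskiTheorem`,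 `PerronAlgebraicInteger`) are imported, never restated; the cell's `lehmerPoly` is the tree's `lehmerPolynomial` (`MinimalMeasuresByDegree.lean`, identical body) and is NOT re-declared.  The Summits originals stay in place (transitional duplication).
-/

noncomputable section

/-!
## Part 1 — port of `Summits/Ventures/DiscreteObjects/Mahler/KroneckerTwoCos.lean` (4 declarations kept)

# Kronecker's theorem on `[-2, 2]`: totally real algebraic integers of house `≤ 2` are `ζ + ζ⁻¹` (venture `DiscreteObjects`, target L)

Cell `pub-namedobj`, seat `pub-namedobj-mahler` (gen 8). Framing: lottery ticket; floor = certified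
bounds/negative ranges.

[Kronecker 1857; McKee–Smyth, *Around the Unit Circle*, Ch. 1 (cyclotomic integers / the interval `[-2,2]`).]
If `P ∈ ℤ[X]` is monic and all its complex roots are real numbers in `[-2, 2]`, then every root of `P` is
`β + β⁻¹ = 2 Re β` for a root of unity `β` (`root_eq_add_inv_of_rootOfUnity`).  Proof: the reciprocal
"lift" `Q(x) = x^d P(x + 1/x) ∈ ℤ[X]` (`traceLift`) has leading coefficient `1` and all its roots on the unit
circle, hence `M(Q) = 1`, so by Kronecker's theorem (Mathlib: `Polynomial.pow_eq_one_of_mahlerMeasure_eq_one`)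
its roots are roots of unity.  This is the mechanism behind the trace polynomials `y = x + 1/x` of the cell's
`LehmerExactMeasure`.
-/

section Part1

namespace Literature.NumberTheory.MahlerMeasure

open _root_.Polynomial

/-- The reciprocal lift `Q(x) = Σ_j a_j x^{d-j} (x² + 1)^j = x^d · P(x + 1/x)` of `P = Σ_j a_j x^j`,
`d = deg P`.
[cite: Kronecker1857, J. reine angew. Math. 53 pp.173–175; see MckeeSmyth2021 Theorem 1.4 p.21 (Kronecker's Second Theorem: a totally real algebraic integer with all conjugates in [−2, 2] is 2cos(2π/ℓ)-conjugate, i.e. ζ + ζ⁻¹)] -/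
noncomputable def traceLift (P : ℤ[X]) : ℤ[X] :=
  ∑ j ∈ Finset.range (P.natDegree + 1), C (P.coeff j) * X ^ (P.natDegree - j) * (X ^ 2 + 1) ^ j

/-- `Q(β) = β^d · P(β + β⁻¹)` for `β ≠ 0`.
[cite: Kronecker1857, J. reine angew. Math. 53 pp.173–175; see MckeeSmyth2021 Theorem 1.4 p.21 (Kronecker's Second Theorem: a totally real algebraic integer with all conjugates in [−2, 2] is 2cos(2π/ℓ)-conjugate, i.e. ζ + ζ⁻¹)] -/
theorem eval_traceLift {P : ℤ[X]} {β : ℂ} (hβ : β ≠ 0) :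
    ((traceLift P).map (Int.castRingHom ℂ)).eval β = β ^ P.natDegree * aeval (β + β⁻¹) P := by
  rw [traceLift, Polynomial.map_sum, eval_finsetSum, aeval_eq_sum_range, Finset.mul_sum]
  refine Finset.sum_congr rfl fun j hj => ?_
  rw [Finset.mem_range] at hj
  rw [Polynomial.map_mul, Polynomial.map_mul, map_C, Polynomial.map_pow, map_X, Polynomial.map_pow,
    Polynomial.map_add, Polynomial.map_pow, map_X, Polynomial.map_one, eval_mul, eval_mul, eval_C,
    eval_pow, eval_X, eval_pow, eval_add, eval_pow, eval_X, eval_one, eq_intCast, zsmul_eq_mul]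
  have e : (β ^ 2 + 1) = β * (β + β⁻¹) := by field_simp
  rw [e, mul_pow, show β ^ P.natDegree = β ^ (P.natDegree - j) * β ^ j by
    rw [← pow_add, Nat.sub_add_cancel (by omega)]]
  ring

/-- The lift has degree `≤ 2d` and coefficient `1·lc(P)` in degree `2d`.
[cite: Kronecker1857, J. reine angew. Math. 53 pp.173–175; see MckeeSmyth2021 Theorem 1.4 p.21 (Kronecker's Second Theorem: a totally real algebraic integer with all conjugates in [−2, 2] is 2cos(2π/ℓ)-conjugate, i.e. ζ + ζ⁻¹)] -/
theorem traceLift_coeff_two_mul (P : ℤ[X]) :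
    (traceLift P).natDegree ≤ 2 * P.natDegree ∧ (traceLift P).coeff (2 * P.natDegree) = P.leadingCoeff := by
  have hterm : ∀ j ∈ Finset.range (P.natDegree + 1),
      (C (P.coeff j) * X ^ (P.natDegree - j) * (X ^ 2 + 1) ^ j : ℤ[X]).natDegree ≤ P.natDegree + j := by
    intro j hj
    rw [Finset.mem_range] at hj
    calc (C (P.coeff j) * X ^ (P.natDegree - j) * (X ^ 2 + 1) ^ j : ℤ[X]).natDegree
        ≤ (C (P.coeff j) * X ^ (P.natDegree - j)).natDegree + ((X ^ 2 + 1 : ℤ[X]) ^ j).natDegree :=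
          natDegree_mul_le
      _ ≤ (P.natDegree - j) + 2 * j := by
          gcongr
          · exact (natDegree_C_mul_le _ _).trans (natDegree_X_pow_le _)
          · refine natDegree_pow_le.trans ?_
            have : (X ^ 2 + 1 : ℤ[X]).natDegree = 2 := by compute_degree!
            rw [this, mul_comm]
      _ = P.natDegree + j := by omega
  constructor
  · rw [traceLift]
    refine (natDegree_sum_le _ _).trans ?_
    refine Finset.sup_le fun j hj => ?_
    have := hterm j hj
    rw [Finset.mem_range] at hj
    exact (this.trans (by omega))
  · rw [traceLift, finsetSum_coeff, Finset.sum_eq_single P.natDegree]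
    · -- the top term
      have hm : ((X ^ 2 + 1 : ℤ[X]) ^ P.natDegree).Monic := by
        have : (X ^ 2 + 1 : ℤ[X]).Monic := by monicity!
        exact this.pow _
      have hdeg : ((X ^ 2 + 1 : ℤ[X]) ^ P.natDegree).natDegree = 2 * P.natDegree := by
        rw [natDegree_pow, show (X ^ 2 + 1 : ℤ[X]).natDegree = 2 by compute_degree!, mul_comm]
      rw [Nat.sub_self, pow_zero, mul_one, coeff_C_mul, ← hdeg, hm.coeff_natDegree, mul_one,
        coeff_natDegree]
    · intro j hj hne
      rw [Finset.mem_range] at hj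
      apply coeff_eq_zero_of_natDegree_lt
      exact (hterm j (Finset.mem_range.mpr hj)).trans_lt (by omega)
    · intro h
      exact absurd (Finset.mem_range.mpr (Nat.lt_succ_self _)) h

/-- **Kronecker's theorem on `[-2, 2]`** (Kronecker 1857): if `P ∈ ℤ[X]` is monic and every complex root of
`P` is real with absolute value `≤ 2`, then every root `α` of `P` is `β + β⁻¹` (`= 2 Re β`) for some root
of unity `β` (`β^n = 1`, `n ≥ 1`).
[cite: Kronecker1857, J. reine angew. Math. 53 pp.173–175; see MckeeSmyth2021 Theorem 1.4 p.21 (Kronecker's Second Theorem: a totally real algebraic integer with all conjugates in [−2, 2] is 2cos(2π/ℓ)-conjugate, i.e. ζ + ζ⁻¹)] -/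
theorem root_eq_add_inv_of_rootOfUnity {P : ℤ[X]} (hmonic : P.Monic)
    (hreal : ∀ α ∈ (P.map (Int.castRingHom ℂ)).roots, α.im = 0 ∧ ‖α‖ ≤ 2)
    {α : ℂ} (hα : α ∈ (P.map (Int.castRingHom ℂ)).roots) :
    ∃ β : ℂ, ∃ n : ℕ, 0 < n ∧ β ^ n = 1 ∧ α = β + β⁻¹ := by
  have hinj : Function.Injective (Int.castRingHom ℂ) := (Int.castRingHom ℂ).injective_int
  have hP0 : P.map (Int.castRingHom ℂ) ≠ 0 := (mem_roots'.mp hα).1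
  set Q := traceLift P with hQdef
  obtain ⟨hQdeg, hQtop⟩ := traceLift_coeff_two_mul P
  rw [hmonic.leadingCoeff] at hQtop
  have hQnat : Q.natDegree = 2 * P.natDegree :=
    le_antisymm hQdeg (le_natDegree_of_ne_zero (by rw [hQtop]; exact one_ne_zero))
  have hQlc : Q.leadingCoeff = 1 := by rw [leadingCoeff, hQnat, hQtop]
  have hQ0 : Q ≠ 0 := by intro h; rw [h, leadingCoeff_zero] at hQlc; exact zero_ne_one hQlc
  have hQC0 : Q.map (Int.castRingHom ℂ) ≠ 0 := (Polynomial.map_ne_zero_iff hinj).mpr hQ0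
  -- every root `β` of `Q` is nonzero, and `β + β⁻¹` is a root of `P`, so `|β| = 1`
  have hQcoeff0 : Q.coeff 0 = 1 := by
    rw [coeff_zero_eq_eval_zero, hQdef, traceLift, eval_finsetSum,
      Finset.sum_eq_single_of_mem P.natDegree (Finset.mem_range.mpr (Nat.lt_succ_self _))]
    · rw [Nat.sub_self, pow_zero, mul_one, eval_mul, eval_C, eval_pow, eval_add, eval_pow, eval_X,
        eval_one, coeff_natDegree, hmonic.leadingCoeff]
      norm_num
    · intro j hj hne
      rw [Finset.mem_range] at hj
      have hdj : P.natDegree - j ≠ 0 := by omega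
      rw [eval_mul, eval_mul, eval_pow, eval_X, zero_pow hdj, mul_zero, zero_mul]
  have hQeval0 : (Q.map (Int.castRingHom ℂ)).eval 0 ≠ 0 := by
    rw [eval_map, eval₂_at_zero, eq_intCast, hQcoeff0]
    norm_num
  have hβroot : ∀ β ∈ (Q.map (Int.castRingHom ℂ)).roots, β ≠ 0 ∧ β + β⁻¹ ∈ (P.map (Int.castRingHom ℂ)).roots := by
    intro β hβ
    have hev : (Q.map (Int.castRingHom ℂ)).eval β = 0 := (mem_roots hQC0).mp hβ
    have hβ0 : β ≠ 0 := by rintro rfl; exact hQeval0 hev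
    refine ⟨hβ0, ?_⟩
    rw [hQdef, eval_traceLift hβ0] at hev
    rcases mul_eq_zero.mp hev with h | h
    · exact absurd (pow_eq_zero_iff'.mp h).1 hβ0
    · rw [mem_roots hP0, IsRoot.def, ← algebraMap_int_eq, eval_map_algebraMap]
      exact h
  have hnorm : ∀ β ∈ (Q.map (Int.castRingHom ℂ)).roots, ‖β‖ = 1 := by
    intro β hβ
    obtain ⟨hβ0, hγ⟩ := hβroot β hβ
    obtain ⟨him, hle⟩ := hreal _ hγ
    -- `β² - γ β + 1 = 0` with `γ` real, `|γ| ≤ 2` forces `|β| = 1`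
    set γ := β + β⁻¹ with hγdef
    have hquad : β ^ 2 - γ * β + 1 = 0 := by rw [hγdef]; field_simp; ring
    -- write `β = x + iy`; compare with the conjugate root
    have hγreal : γ = ((γ.re : ℝ) : ℂ) := by
      apply Complex.ext <;> simp [him]
    have hprod : β * (starRingEnd ℂ β) = ((‖β‖ ^ 2 : ℝ) : ℂ) := by
      rw [Complex.mul_conj, Complex.normSq_eq_norm_sq, Complex.ofReal_pow]
    -- the conjugate `β̄` satisfies the same real quadratic, so `β̄ ∈ {β, 1/β}`:
    have hconj : (starRingEnd ℂ β) ^ 2 - γ * (starRingEnd ℂ β) + 1 = 0 := by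
      have h := congrArg (starRingEnd ℂ) hquad
      rw [map_add, map_sub, map_mul, map_pow, map_one, map_zero, hγreal, Complex.conj_ofReal] at h
      rw [hγreal]; exact h
    -- (β̄ - β)(β̄ - β⁻¹) = β̄² - γ β̄ + 1 = 0 since β + β⁻¹ = γ and β β⁻¹ = 1
    have hfac : (starRingEnd ℂ β - β) * (starRingEnd ℂ β - β⁻¹) = 0 := by
      have : (starRingEnd ℂ β - β) * (starRingEnd ℂ β - β⁻¹) =
          (starRingEnd ℂ β) ^ 2 - γ * starRingEnd ℂ β + β * β⁻¹ := by rw [hγdef]; ring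
      rw [this, mul_inv_cancel₀ hβ0]
      exact hconj
    rcases mul_eq_zero.mp hfac with h | h
    · -- `β` real: `β² - γβ + 1 = 0` with `|γ| ≤ 2` real forces `γ = ±2`, `β = ±1`
      have hβreal : β = ((β.re : ℝ) : ℂ) := by
        apply Complex.ext
        · simp
        · have := congrArg Complex.im (sub_eq_zero.mp h)
          simp only [Complex.conj_im] at this
          simp; linarith
      have hx : (β.re) ^ 2 - γ.re * β.re + 1 = 0 := by
        have h2 := hquad
        rw [hβreal, hγreal] at h2
        exact_mod_cast h2
      have hγle : |γ.re| ≤ 2 := by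
        have := Complex.abs_re_le_norm γ
        linarith
      -- discriminant `γ² - 4 ≤ 0` and a real root ⇒ `γ² = 4`, `β.re = γ/2 = ±1`
      have habs : |β.re| = 1 := by
        have h4 : (2 * β.re - γ.re) ^ 2 = γ.re ^ 2 - 4 := by nlinarith
        obtain ⟨hg1, hg2⟩ := abs_le.mp hγle
        have hγ2 : γ.re ^ 2 ≤ 4 := by nlinarith
        have hsq : (2 * β.re - γ.re) ^ 2 = 0 :=
          le_antisymm (by nlinarith [sq_nonneg (2 * β.re - γ.re)]) (sq_nonneg _)
        have h5 : 2 * β.re - γ.re = 0 := by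
          have := sq_eq_zero_iff.mp hsq
          exact this
        have hsq1 : β.re ^ 2 = 1 := by nlinarith
        have h3 : (|β.re| - 1) * (|β.re| + 1) = 0 := by nlinarith [sq_abs β.re, abs_nonneg β.re]
        rcases mul_eq_zero.mp h3 with h6 | h6
        · linarith
        · linarith [abs_nonneg β.re]
      rw [hβreal, Complex.norm_real, Real.norm_eq_abs, habs]
    · -- `β̄ = β⁻¹`: `|β|² = β β̄ = 1`
      have h1 : β * starRingEnd ℂ β = 1 := by rw [sub_eq_zero.mp h, mul_inv_cancel₀ hβ0]
      rw [hprod] at h1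
      have : ‖β‖ ^ 2 = 1 := by exact_mod_cast h1
      nlinarith [norm_nonneg β]
  -- hence `M(Q) = 1`
  have hMQ : (Q.map (Int.castRingHom ℂ)).mahlerMeasure = 1 := by
    rw [mahlerMeasure_eq_leadingCoeff_mul_prod_roots, leadingCoeff_map_of_injective hinj, hQlc, map_one,
      norm_one, one_mul]
    apply Multiset.prod_eq_one
    intro x hx
    rw [Multiset.mem_map] at hx
    obtain ⟨β, hβ, rfl⟩ := hx
    rw [hnorm β hβ, max_self]
  -- a root `β` of `Q` above `α`
  obtain ⟨him, hle⟩ := hreal α hα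
  obtain ⟨r, hr⟩ := IsAlgClosed.exists_pow_nat_eq (α ^ 2 - 4) (by norm_num : 0 < 2)
  have hdisc : discrim (1 : ℂ) (-α) 1 = r * r := by rw [discrim]; linear_combination -hr
  obtain ⟨β, hβdef⟩ : ∃ β : ℂ, β = (-(-α) + r) / (2 * 1) := ⟨_, rfl⟩
  have hβquad : 1 * (β * β) + (-α) * β + 1 = 0 :=
    (quadratic_eq_zero_iff one_ne_zero hdisc β).mpr (Or.inl hβdef)
  have hβ0 : β ≠ 0 := by
    intro h; rw [h] at hβquad; norm_num at hβquad
  have hαβ : α = β + β⁻¹ := by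
    have h1 : α * β = β * β + 1 := by linear_combination -hβquad
    field_simp
    linear_combination h1
  have hβQ : β ∈ (Q.map (Int.castRingHom ℂ)).roots := by
    rw [mem_roots hQC0, IsRoot.def, hQdef, eval_traceLift hβ0, ← hαβ]
    have : aeval α P = 0 := by
      have h := (mem_roots hP0).mp hα
      rwa [IsRoot.def, ← algebraMap_int_eq, eval_map_algebraMap] at h
    rw [this, mul_zero]
  have hβar : β ∈ Q.aroots ℂ := by
    rw [aroots_def, algebraMap_int_eq]; exact hβQ
  obtain ⟨n, hn, hβn⟩ := Polynomial.pow_eq_one_of_mahlerMeasure_eq_one hMQ hβ0 hβar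
  exact ⟨β, n, hn, hβn, hαβ⟩

end Literature.NumberTheory.MahlerMeasure

end Part1

/-!
## Part 2 — port of `Summits/Ventures/DiscreteObjects/Mahler/GoncalvesInequality.lean` (9 declarations kept)

# Gonçalves' inequality (venture `DiscreteObjects`, target L)

Cell `pub-namedobj`, seat `pub-namedobj-mahler` (gen 10). Framing: lottery ticket; floor = certified
bounds/negative ranges.

[McKee–Smyth, *Around the Unit Circle*, Prop. 1.12 (Gonçalves' Inequality) and Exercise 1.15 (complex
coefficients)]: for `P(z) = a_d z^d + ⋯ + a_0 ∈ ℂ[z]` with `d ≥ 1` and `a_0 a_d ≠ 0`,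
`M(P)² + |a_0 a_d|² / M(P)² ≤ ∑ |a_j|²`.
This sharpens Landau's (Specht's) inequality `M(P) ≤ √(∑ |a_j|²)` (Mathlib
`mahlerMeasure_le_sqrt_sum_sq_norm_coeff`), and gives the explicit bound
`M(P)² ≤ (N + √(N² - 4|a_0 a_d|²))/2`, `N = ∑ |a_j|²` — for the census (target L): a monic integer
polynomial with `P(0) = ±1` and `N` nonzero coefficients of absolute value `1` has `M(P)² ≤ (N + √(N²-4))/2`.

Kernel route (algebraic form of the book's proof).  Replacing a factor `z - α` of `P` by `ᾱ z - 1`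
does not change `|P|` on the unit circle, hence (Parseval, Mathlib `sum_sq_norm_coeff_eq_circleAverage`)
does not change `∑ |a_j|²` (`sum_sq_norm_coeff_flip`).  Flipping every root inside the unit disc turns
`P = a ∏ (z - α)` into `R = a ∏_{|α|≥1} (z - α) ∏_{|α|<1} (ᾱ z - 1)` with `|R(0)| = |a| ∏_{|α|≥1} |α| = M(P)`
and `|lc(R)| = |a| ∏_{|α|<1} |α| = |a a_0| / M(P)`, and `∑|a_j|² = ∑ |R_j|² ≥ |R(0)|² + |lc(R)|²`.

* `sum_sq_norm_coeff_flip`, `sum_sq_norm_coeff_multiflip` — flipping roots preserves `∑ |a_j|²`;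
* `goncalves_inequality` — complex form; `goncalves_inequality_int` — for `P ∈ ℤ[X]`;
* `mahlerMeasure_sq_le_goncalves` — `M(P)² ≤ (N + √(N² - 4|a_0 a_d|²))/2`.
-/

section Part2

namespace Literature.NumberTheory.MahlerMeasure

open _root_.Polynomial
open scoped ComplexConjugate

/-! ### Flipping a root across the unit circle -/

/-- On the unit circle, `|ᾱ z - 1| = |z - α|`.
[cite: MckeeSmyth2021, Proposition 1.12 p.24 (Gonçalves' Inequality: M(P)² + a₀²a_d²/M(P)² ≤ Σ a_j²)] -/
theorem norm_conj_mul_sub_one_of_norm_eq_one {z : ℂ} (hz : ‖z‖ = 1) (α : ℂ) :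
    ‖conj α * z - 1‖ = ‖z - α‖ := by
  have h1 : conj z * z = 1 := by
    rw [mul_comm, Complex.mul_conj, Complex.normSq_eq_norm_sq, hz]; norm_num
  have h2 : conj α * z - 1 = conj (α * conj z - 1) := by
    simp [map_sub, map_mul]
  have h3 : α * conj z - 1 = conj z * (α - z) := by linear_combination h1
  rw [h2, Complex.norm_conj, h3, norm_mul, Complex.norm_conj, hz, one_mul, norm_sub_rev]

/-- The flipped linear factor `ᾱ X - 1`, written as `C ᾱ * X + C (-1)`.
[cite: MckeeSmyth2021, Proposition 1.12 p.24 (Gonçalves' Inequality: M(P)² + a₀²a_d²/M(P)² ≤ Σ a_j²)] -/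
theorem eval_flip (α z : ℂ) : (C (conj α) * X + C (-1) : ℂ[X]).eval z = conj α * z - 1 := by
  simp [sub_eq_add_neg]

/-- **Flip lemma.** Replacing the factor `X - α` by `ᾱ X - 1` preserves `∑ |coeff|²`
(Parseval + `|ᾱ z - 1| = |z - α|` on the unit circle).
[cite: MckeeSmyth2021, Proposition 1.12 p.24 (Gonçalves' Inequality: M(P)² + a₀²a_d²/M(P)² ≤ Σ a_j²)] -/
theorem sum_sq_norm_coeff_flip (S : ℂ[X]) (α : ℂ) :
    ∑ i ∈ ((X - C α) * S).support, ‖((X - C α) * S).coeff i‖ ^ 2 =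
      ∑ i ∈ ((C (conj α) * X + C (-1)) * S).support, ‖((C (conj α) * X + C (-1)) * S).coeff i‖ ^ 2 := by
  rw [sum_sq_norm_coeff_eq_circleAverage, sum_sq_norm_coeff_eq_circleAverage]
  apply Real.circleAverage_congr_sphere
  intro z hz
  rw [abs_one, mem_sphere_zero_iff_norm] at hz
  simp only [eval_mul, norm_mul, eval_sub, eval_X, eval_C, eval_flip]
  rw [norm_conj_mul_sub_one_of_norm_eq_one hz α]

/-- **Multi-flip.** Flipping every root of a multiset `I` preserves `∑ |coeff|²`.
[cite: MckeeSmyth2021, Proposition 1.12 p.24 (Gonçalves' Inequality: M(P)² + a₀²a_d²/M(P)² ≤ Σ a_j²)] -/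
theorem sum_sq_norm_coeff_multiflip (I : Multiset ℂ) :
    ∀ G : ℂ[X], ∑ i ∈ ((I.map fun α => X - C α).prod * G).support,
        ‖((I.map fun α => X - C α).prod * G).coeff i‖ ^ 2 =
      ∑ i ∈ ((I.map fun α => C (conj α) * X + C (-1)).prod * G).support,
        ‖((I.map fun α => C (conj α) * X + C (-1)).prod * G).coeff i‖ ^ 2 := by
  induction I using Multiset.induction_on with
  | empty => intro G; simp
  | cons α I ih =>
    intro G
    rw [Multiset.map_cons, Multiset.prod_cons, Multiset.map_cons, Multiset.prod_cons, mul_assoc,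
      sum_sq_norm_coeff_flip, mul_left_comm, ih ((C (conj α) * X + C (-1)) * G), mul_left_comm, mul_assoc]

/-! ### Gonçalves' inequality -/

/-- `‖∏ s‖ = ∏ ‖·‖` over a multiset of complex numbers (local helper).
[cite: MckeeSmyth2021, Proposition 1.12 p.24 (Gonçalves' Inequality: M(P)² + a₀²a_d²/M(P)² ≤ Σ a_j²)] -/
private theorem norm_multiset_prod_norms (s : Multiset ℂ) : ‖s.prod‖ = (s.map fun α => ‖α‖).prod := by
  rw [← normHom_apply, map_multiset_prod]; rfl

/-- `∑_{support} |coeff|² ≥ |coeff 0|² + |lc|²` for a polynomial of positive degree.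
[cite: MckeeSmyth2021, Proposition 1.12 p.24 (Gonçalves' Inequality: M(P)² + a₀²a_d²/M(P)² ≤ Σ a_j²)] -/
theorem sq_coeff_zero_add_sq_leadingCoeff_le (R : ℂ[X]) (hR : 0 < R.natDegree) :
    ‖R.coeff 0‖ ^ 2 + ‖R.leadingCoeff‖ ^ 2 ≤ ∑ i ∈ R.support, ‖R.coeff i‖ ^ 2 := by
  classical
  have hR0 : R ≠ 0 := by rintro rfl; simp at hR
  by_cases hc0 : R.coeff 0 = 0
  · rw [hc0, norm_zero, zero_pow two_ne_zero, zero_add]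
    have hmem : R.natDegree ∈ R.support := natDegree_mem_support_of_nonzero hR0
    exact Finset.single_le_sum (f := fun i => ‖R.coeff i‖ ^ 2) (fun i _ => sq_nonneg _) hmem
  · have hsub : ({0, R.natDegree} : Finset ℕ) ⊆ R.support := by
      intro i hi
      rw [Finset.mem_insert, Finset.mem_singleton] at hi
      rcases hi with rfl | rfl
      · exact mem_support_iff.mpr hc0
      · exact natDegree_mem_support_of_nonzero hR0
    have h := Finset.sum_le_sum_of_subset_of_nonneg hsub (f := fun i => ‖R.coeff i‖ ^ 2)
      (fun i _ _ => sq_nonneg _)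
    rwa [Finset.sum_pair (Nat.pos_iff_ne_zero.mp hR).symm] at h

/-- **Gonçalves' inequality** ([McKee–Smyth, Prop. 1.12; Exercise 1.15] for complex coefficients):
for `P ∈ ℂ[X]` of degree `d ≥ 1` with `P(0) ≠ 0`,
`M(P)² + (|P(0)|·|lc(P)| / M(P))² ≤ ∑_j |a_j|²`.
[cite: MckeeSmyth2021, Proposition 1.12 p.24 (Gonçalves' Inequality: M(P)² + a₀²a_d²/M(P)² ≤ Σ a_j²)] -/
theorem goncalves_inequality (P : ℂ[X]) (hdeg : 0 < P.natDegree) (h0 : P.coeff 0 ≠ 0) :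
    P.mahlerMeasure ^ 2 + (‖P.coeff 0‖ * ‖P.leadingCoeff‖ / P.mahlerMeasure) ^ 2 ≤
      ∑ i ∈ P.support, ‖P.coeff i‖ ^ 2 := by
  classical
  have hP : P ≠ 0 := by rintro rfl; simp at hdeg
  set a := P.leadingCoeff with ha
  have ha0 : a ≠ 0 := leadingCoeff_ne_zero.mpr hP
  set R₀ := P.roots with hR₀
  have hsplit : P = C a * (R₀.map fun α => X - C α).prod := (IsAlgClosed.splits P).eq_prod_roots
  -- roots are nonzero
  have hroot0 : ∀ α ∈ R₀, α ≠ 0 := by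
    intro α hα h
    rw [h, hR₀, mem_roots hP, IsRoot.def, ← coeff_zero_eq_eval_zero] at hα
    exact h0 hα
  -- split the roots: inside the open unit disc / the rest
  set inn := R₀.filter fun α => ‖α‖ < 1 with hinn
  set out := R₀.filter fun α => ¬ ‖α‖ < 1 with hout
  have hsplit₀ : inn + out = R₀ := Multiset.filter_add_not _ R₀
  set G : ℂ[X] := C a * (out.map fun α => X - C α).prod with hG
  have hPG : P = (inn.map fun α => X - C α).prod * G := by
    rw [hG, hsplit, ← hsplit₀, Multiset.map_add, Multiset.prod_add]; ring
  set Rf : ℂ[X] := (inn.map fun α => C (conj α) * X + C (-1)).prod * G with hRf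
  have hN : ∑ i ∈ P.support, ‖P.coeff i‖ ^ 2 = ∑ i ∈ Rf.support, ‖Rf.coeff i‖ ^ 2 := by
    rw [hPG, hRf]; exact sum_sq_norm_coeff_multiflip inn G
  -- leading coefficient of `Rf`
  have hlin : ∀ α ∈ inn, (C (conj α) * X + C (-1) : ℂ[X]).leadingCoeff = conj α := by
    intro α hα
    have hα0 : conj α ≠ 0 := by
      rw [map_ne_zero_iff _ (RingHom.injective _)]
      exact hroot0 α (Multiset.mem_of_mem_filter hα)
    exact leadingCoeff_linear hα0
  have hleadRf : Rf.leadingCoeff = (inn.map fun α => conj α).prod * a := by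
    rw [hRf, leadingCoeff_mul, leadingCoeff_multiset_prod, Multiset.map_map, hG, leadingCoeff_mul,
      leadingCoeff_C, leadingCoeff_multiset_prod, Multiset.map_map]
    have h1 : (out.map (Polynomial.leadingCoeff ∘ fun α => X - C α)) = out.map fun _ => (1 : ℂ) :=
      Multiset.map_congr rfl fun α _ => by simp [leadingCoeff_X_sub_C]
    have h2 : (inn.map (Polynomial.leadingCoeff ∘ fun α => C (conj α) * X + C (-1))) =
        inn.map fun α => conj α := Multiset.map_congr rfl fun α hα => hlin α hα
    rw [h1, h2, Multiset.map_const', Multiset.prod_replicate, one_pow, mul_one]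
  -- constant coefficient of `Rf`
  have hc0Rf : Rf.coeff 0 = (inn.map fun _ => (-1 : ℂ)).prod * (a * (out.map fun α => -α).prod) := by
    rw [hRf, mul_coeff_zero, coeff_zero_multiset_prod, Multiset.map_map, hG, mul_coeff_zero, coeff_C_zero,
      coeff_zero_multiset_prod, Multiset.map_map]
    congr 1
    · exact congrArg _ (Multiset.map_congr rfl fun α _ => by simp)
    · congr 1
      exact congrArg _ (Multiset.map_congr rfl fun α _ => by simp)
  -- norms
  have hnormRf0 : ‖Rf.coeff 0‖ = ‖a‖ * (out.map fun α => ‖α‖).prod := by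
    rw [hc0Rf, norm_mul, norm_mul]
    have h1 : ‖(inn.map fun _ => (-1 : ℂ)).prod‖ = 1 := by
      rw [Multiset.map_const', Multiset.prod_replicate, norm_pow, norm_neg, norm_one, one_pow]
    have h2 : ‖(out.map fun α => -α).prod‖ = (out.map fun α => ‖α‖).prod := by
      rw [norm_multiset_prod_norms, Multiset.map_map]
      exact congrArg _ (Multiset.map_congr rfl fun α _ => by simp)
    rw [h1, h2, one_mul]
  have hnormlead : ‖Rf.leadingCoeff‖ = (inn.map fun α => ‖α‖).prod * ‖a‖ := by
    rw [hleadRf, norm_mul, norm_multiset_prod_norms, Multiset.map_map]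
    congr 1
    exact congrArg _ (Multiset.map_congr rfl fun α _ => by simp)
  -- `M(P) = |a| ∏_{out} |α|`
  have hM : P.mahlerMeasure = ‖a‖ * (out.map fun α => ‖α‖).prod := by
    rw [mahlerMeasure_eq_leadingCoeff_mul_prod_roots, ← ha, ← hR₀, ← hsplit₀, Multiset.map_add,
      Multiset.prod_add]
    have h1 : (inn.map fun α => max 1 ‖α‖) = inn.map fun _ => (1 : ℝ) :=
      Multiset.map_congr rfl fun α hα => max_eq_left (le_of_lt (Multiset.mem_filter.mp hα).2)
    have h2 : (out.map fun α => max 1 ‖α‖) = out.map fun α => ‖α‖ :=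
      Multiset.map_congr rfl fun α hα => max_eq_right (not_lt.mp (Multiset.mem_filter.mp hα).2)
    rw [h1, h2, Multiset.map_const', Multiset.prod_replicate, one_pow, one_mul]
  -- `|P(0)| = |a| ∏_{all} |α| = M(P) · ∏_{inn} |α|`
  have hP0 : ‖P.coeff 0‖ = P.mahlerMeasure * (inn.map fun α => ‖α‖).prod := by
    have h1 : P.coeff 0 = a * (R₀.map fun α => -α).prod := by
      conv_lhs => rw [hsplit]
      rw [mul_coeff_zero, coeff_C_zero, coeff_zero_multiset_prod, Multiset.map_map]
      congr 1
      exact congrArg _ (Multiset.map_congr rfl fun α _ => by simp)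
    rw [h1, norm_mul, norm_multiset_prod_norms, Multiset.map_map, hM, ← hsplit₀]
    have h2 : (inn + out).map ((fun α : ℂ => ‖α‖) ∘ fun α : ℂ => -α) = (inn + out).map fun α => ‖α‖ :=
      Multiset.map_congr rfl fun α _ => by simp
    rw [h2, Multiset.map_add, Multiset.prod_add]
    ring
  have hMpos : 0 < P.mahlerMeasure := mahlerMeasure_pos_of_ne_zero hP
  -- degree of `Rf` is positive: it has a root
  have hRf0 : Rf ≠ 0 := by
    intro h
    have := congrArg (fun p : ℂ[X] => ∑ i ∈ p.support, ‖p.coeff i‖ ^ 2) h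
    simp only [support_zero, Finset.sum_empty] at this
    rw [← hN] at this
    have hmem : P.natDegree ∈ P.support := natDegree_mem_support_of_nonzero hP
    have hle := Finset.single_le_sum (f := fun i => ‖P.coeff i‖ ^ 2) (fun i _ => sq_nonneg _) hmem
    rw [this] at hle
    have : ‖P.leadingCoeff‖ ^ 2 ≤ 0 := hle
    exact ha0 (norm_eq_zero.mp (by nlinarith [norm_nonneg P.leadingCoeff]))
  have hRfdeg : 0 < Rf.natDegree := by
    -- pick a root of `P`; its flipped or unflipped linear factor divides `Rf`
    have hcard : 0 < Multiset.card R₀ := by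
      rw [hR₀, splits_iff_card_roots.mp (IsAlgClosed.splits P)]; exact hdeg
    obtain ⟨α, hα⟩ := Multiset.card_pos_iff_exists_mem.mp hcard
    rw [← hsplit₀, Multiset.mem_add] at hα
    apply natDegree_pos_iff_degree_pos.mpr
    rcases hα with hα | hα
    · have hα0 : conj α ≠ 0 := by
        rw [map_ne_zero_iff _ (RingHom.injective _)]
        exact hroot0 α (Multiset.mem_of_mem_filter hα)
      refine degree_pos_of_root hRf0 (a := (conj α)⁻¹) ?_
      have hdvd : (C (conj α) * X + C (-1) : ℂ[X]) ∣ Rf := by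
        rw [hRf]; exact (Multiset.dvd_prod (Multiset.mem_map_of_mem _ hα)).mul_right _
      obtain ⟨T, hT⟩ := hdvd
      rw [IsRoot.def, hT, eval_mul, eval_flip, mul_inv_cancel₀ hα0, sub_self, zero_mul]
    · refine degree_pos_of_root hRf0 (a := α) ?_
      have hdvd : (X - C α : ℂ[X]) ∣ Rf := by
        rw [hRf, hG]
        exact ((Multiset.dvd_prod (Multiset.mem_map_of_mem _ hα)).mul_left _).mul_left _
      obtain ⟨T, hT⟩ := hdvd
      rw [IsRoot.def, hT, eval_mul, eval_sub, eval_X, eval_C, sub_self, zero_mul]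
  -- assemble
  have hkey := sq_coeff_zero_add_sq_leadingCoeff_le Rf hRfdeg
  rw [← hN, hnormRf0, ← hM, hnormlead] at hkey
  have hlead_eq : (inn.map fun α => ‖α‖).prod * ‖a‖ = ‖P.coeff 0‖ * ‖P.leadingCoeff‖ / P.mahlerMeasure := by
    rw [hP0, ← ha]
    field_simp
  rw [hlead_eq] at hkey
  exact hkey

/-- **Gonçalves' bound solved for `M(P)²`:** with `N = ∑ |a_j|²` and `c = |a_0 a_d|`,
`M(P)² ≤ (N + √(N² - 4c²)) / 2`.
[cite: MckeeSmyth2021, Proposition 1.12 p.24 (Gonçalves' Inequality: M(P)² + a₀²a_d²/M(P)² ≤ Σ a_j²)] -/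
theorem mahlerMeasure_sq_le_goncalves (P : ℂ[X]) (hdeg : 0 < P.natDegree) (h0 : P.coeff 0 ≠ 0) :
    P.mahlerMeasure ^ 2 ≤ ((∑ i ∈ P.support, ‖P.coeff i‖ ^ 2) +
      Real.sqrt ((∑ i ∈ P.support, ‖P.coeff i‖ ^ 2) ^ 2 -
        4 * (‖P.coeff 0‖ * ‖P.leadingCoeff‖) ^ 2)) / 2 := by
  have hP : P ≠ 0 := by rintro rfl; simp at hdeg
  have hMpos : 0 < P.mahlerMeasure := mahlerMeasure_pos_of_ne_zero hP
  have h := goncalves_inequality P hdeg h0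
  set N := ∑ i ∈ P.support, ‖P.coeff i‖ ^ 2 with hNdef
  set c := ‖P.coeff 0‖ * ‖P.leadingCoeff‖ with hc
  set m := P.mahlerMeasure ^ 2 with hm
  have hm0 : 0 < m := by positivity
  -- `m + c²/m ≤ N` ⇒ `m² - N m + c² ≤ 0` ⇒ `(2m - N)² ≤ N² - 4c²`
  have h1 : m + c ^ 2 / m ≤ N := by
    have : (c / P.mahlerMeasure) ^ 2 = c ^ 2 / m := by rw [hm, div_pow]
    linarith [h, this]
  have h2 : m * m + c ^ 2 ≤ N * m := by
    have := mul_le_mul_of_nonneg_right h1 hm0.le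
    rwa [add_mul, div_mul_cancel₀ _ hm0.ne'] at this
  have h3 : (2 * m - N) ^ 2 ≤ N ^ 2 - 4 * c ^ 2 := by nlinarith
  have h4 : 2 * m - N ≤ Real.sqrt (N ^ 2 - 4 * c ^ 2) := by
    calc 2 * m - N ≤ |2 * m - N| := le_abs_self _
      _ = Real.sqrt ((2 * m - N) ^ 2) := (Real.sqrt_sq_eq_abs _).symm
      _ ≤ Real.sqrt (N ^ 2 - 4 * c ^ 2) := Real.sqrt_le_sqrt h3
  linarith

/-- **Gonçalves' inequality for integer polynomials:** for `P ∈ ℤ[X]` of degree `≥ 1` with `P(0) ≠ 0`,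
`M(P)² + (P(0)·lc(P) / M(P))² ≤ ∑_j a_j²`.
[cite: MckeeSmyth2021, Proposition 1.12 p.24 (Gonçalves' Inequality: M(P)² + a₀²a_d²/M(P)² ≤ Σ a_j²)] -/
theorem goncalves_inequality_int (P : ℤ[X]) (hdeg : 0 < P.natDegree) (h0 : P.coeff 0 ≠ 0) :
    intMahlerMeasure P ^ 2 + ((P.coeff 0 : ℝ) * P.leadingCoeff / intMahlerMeasure P) ^ 2 ≤
      ∑ i ∈ P.support, ((P.coeff i : ℝ)) ^ 2 := by
  have hinj := (Int.castRingHom ℂ).injective_int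
  have h := goncalves_inequality (P.map (Int.castRingHom ℂ))
    (by rwa [natDegree_map_eq_of_injective hinj]) (by rw [coeff_map, eq_intCast]; exact_mod_cast h0)
  unfold intMahlerMeasure
  rw [support_map_of_injective P hinj, leadingCoeff_map_of_injective hinj] at h
  simp only [coeff_map, eq_intCast, Complex.norm_intCast] at h
  have h1 : ∑ x ∈ P.support, |((P.coeff x : ℤ) : ℝ)| ^ 2 = ∑ i ∈ P.support, ((P.coeff i : ℝ)) ^ 2 :=
    Finset.sum_congr rfl fun i _ => sq_abs _
  have h2 : (|((P.coeff 0 : ℤ) : ℝ)| * |((P.leadingCoeff : ℤ) : ℝ)| /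
      (P.map (Int.castRingHom ℂ)).mahlerMeasure) ^ 2 =
      (((P.coeff 0 : ℤ) : ℝ) * P.leadingCoeff / (P.map (Int.castRingHom ℂ)).mahlerMeasure) ^ 2 := by
    rw [← abs_mul, div_pow, div_pow, sq_abs]
  rw [h1, h2] at h
  exact h

end Literature.NumberTheory.MahlerMeasure

end Part2

/-!
## Part 3 — port of `Summits/Ventures/DiscreteObjects/Mahler/VandermondeProductBound.lean` (3 declarations kept)

# The Vandermonde product bound `∏_{i≠j} |z_i - z_j| ≤ d^d · M(z)^{2(d-1)}` (venture `DiscreteObjects`, target L)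

Cell `pub-namedobj`, seat `pub-namedobj-mahler-g26`. Framing: lottery ticket; floor = certified bounds/negative ranges.

[cite: MckeeSmyth2021, Lemma 3.7]: for `z = (z_1, …, z_d) ∈ ℂ^d`,
`∏_{i ≠ j} |z_i - z_j| ≤ (M(z)² d)^d` where `M(z) = ∏_i max(1, |z_i|)`; here in the slightly sharper printed
intermediate form `≤ d^d · M(z)^{2(d-1)}`.  Proof as printed: the left side is `|det V(z)|²` for the Vandermonde matrix
(`Literature…Discrepancy.vandermondeAbs`, `prod_Ioi_sq_eq_prod_erase`), and Hadamard's inequality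
(`Literature.Analysis.Matrix.norm_det_sq_le_of_entry_le`, row entries `|z_i^k| ≤ max(1,|z_i|)^{d-1}`) bounds it.
REPLICATION; a brick for the cell's planned kernel proof of the weak Dobrowolski bound `M(α) > 1 + 1/(22d)`
([MckeeSmyth2021, Thm 3.11]) — applied there to the `2d` points `(α_i^p, α_i)`.
-/

section Part3

namespace Literature.NumberTheory.MahlerMeasure

open _root_.Finset Literature.NumberTheory.DiophantineApproximation.Discrepancy

/-- `∏_{i ≠ j} |z_i - z_j| = |V(z)|²`.
[cite: MckeeSmyth2021, Lemma 3.7 p.65 (∏_{i≠j} |z_i − z_j| ≤ d^d M(z)^{2(d−1)}, via Hadamard's inequality)] -/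
theorem prod_erase_norm_sub_eq_vandermondeAbs_sq {d : ℕ} (z : Fin d → ℂ) :
    ∏ i, ∏ j ∈ univ.erase i, ‖z i - z j‖ = vandermondeAbs z ^ 2 := by
  rw [← prod_Ioi_sq_eq_prod_erase (fun i j => ‖z i - z j‖) (fun i j => norm_sub_rev _ _)]
  unfold vandermondeAbs
  congr 1
  refine Finset.prod_congr rfl fun i _ => Finset.prod_congr rfl fun j _ => ?_
  exact norm_sub_rev _ _

/-- **[MckeeSmyth2021, Lemma 3.7]** `∏_{i ≠ j} |z_i - z_j| ≤ d^d · (∏_i max(1,|z_i|))^{2(d-1)}`.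
[cite: MckeeSmyth2021, Lemma 3.7 p.65 (∏_{i≠j} |z_i − z_j| ≤ d^d M(z)^{2(d−1)}, via Hadamard's inequality)] -/
theorem prod_erase_norm_sub_le {d : ℕ} (z : Fin d → ℂ) :
    ∏ i, ∏ j ∈ univ.erase i, ‖z i - z j‖ ≤ (d : ℝ) ^ d * (∏ i, max 1 ‖z i‖) ^ (2 * (d - 1)) := by
  rw [prod_erase_norm_sub_eq_vandermondeAbs_sq, vandermondeAbs_eq_norm_det]
  have h := Literature.Analysis.Matrix.norm_det_sq_le_of_entry_le (Matrix.vandermonde z)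
    (fun i => (max 1 ‖z i‖) ^ (d - 1)) (fun i j => by
      rw [Matrix.vandermonde_apply, norm_pow]
      calc ‖z i‖ ^ (j : ℕ) ≤ (max 1 ‖z i‖) ^ (j : ℕ) :=
            pow_le_pow_left₀ (norm_nonneg _) (le_max_right _ _) _
        _ ≤ (max 1 ‖z i‖) ^ (d - 1) := pow_le_pow_right₀ (le_max_left _ _) (by omega))
  refine h.trans (le_of_eq ?_)
  rw [Finset.prod_mul_distrib, Finset.prod_const, Finset.card_univ, Fintype.card_fin, ← Finset.prod_pow]
  congr 1
  refine Finset.prod_congr rfl fun i _ => ?_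
  rw [← pow_mul, mul_comm]

/-- The printed form of [MckeeSmyth2021, Lemma 3.7]: `∏_{i ≠ j} |z_i - z_j| ≤ (M(z)² · d)^d`.
[cite: MckeeSmyth2021, Lemma 3.7 p.65 (∏_{i≠j} |z_i − z_j| ≤ d^d M(z)^{2(d−1)}, via Hadamard's inequality)] -/
theorem prod_erase_norm_sub_le' {d : ℕ} (z : Fin d → ℂ) :
    ∏ i, ∏ j ∈ univ.erase i, ‖z i - z j‖ ≤ ((∏ i, max 1 ‖z i‖) ^ 2 * d) ^ d := by
  refine (prod_erase_norm_sub_le z).trans ?_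
  have hM : 1 ≤ ∏ i, max 1 ‖z i‖ := by
    have : ∏ i : Fin d, (1 : ℝ) ≤ ∏ i, max 1 ‖z i‖ :=
      Finset.prod_le_prod (fun _ _ => zero_le_one) fun _ _ => le_max_left _ _
    simpa using this
  rw [mul_pow, ← pow_mul, mul_comm]
  refine mul_le_mul_of_nonneg_right ?_ (by positivity)
  exact pow_le_pow_right₀ hM (by omega)

end Literature.NumberTheory.MahlerMeasure

end Part3

/-!
## Part 4 — port of `Summits/Ventures/DiscreteObjects/Mahler/DobrowolskiLemma.lean` (2 declarations kept)

# Dobrowolski's lemma `p^{deg f} ∣ Res(f, f(X^p))` and the Dobrowolski–Mignotte length bound (venture `DiscreteObjects`, target L)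

Cell `pub-namedobj`, seat `pub-namedobj-mahler` (gen 8). Framing: lottery ticket; floor = certified
bounds/negative ranges.

* `exists_expand_eq_prime_mul_add` — Dobrowolski's congruence `f(X^p) = p·T + f·f^{p-1}` in `ℤ[X]`
  (`f(X^p) ≡ f(X)^p (mod p)`, Mathlib `ZMod.expand_card`);
* `prime_pow_dvd_resultant_expand` — **Dobrowolski's Lemma** [McKee–Smyth, Lemma A.23; Dobrowolski 1979]
  in resultant form: `p^{deg f} ∣ Res_{(d, dp)}(f, f(X^p))` for every `f ∈ ℤ[X]` and prime `p`
  (for monic irreducible `f` this integer is `∏_{i,j} (α_i^p - α_j)`); `prime_pow_le_abs_resultant_expand`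
  — Cor. A.24: `p^{deg f} ≤ |Res|` when the resultant is nonzero;
* `norm_eval_le_length_mul` — `|f(β)| ≤ L(f) · max(1,|β|)^{deg f}`, `L(f) = Σ |f_i|` the length;
* `prime_le_length_mul_mahlerMeasure_pow` — the **Dobrowolski–Mignotte inequality**
  [McKee–Smyth, proof of Prop. 11.1; Mignotte 1978]: if no `p`-th power of a complex root of `f` is a root
  of `f`, then `p ≤ L(f) · M(f)^p`;
* `two_lt_mahlerMeasure_pow_length` — with Bertrand's postulate (Mathlib): under the same separation
  hypothesis for one prime `p ∈ (2L, 4L]`, `M(f)^{4L} > 2`, i.e. `M(f) > 2^{1/(4L)}`.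

The separation hypothesis holds for every `p ≥ 2` when `f` is irreducible, `f(0) ≠ 0` and `f` has no
cyclotomic factor (`pow_ne_root_of_irreducible`: if `α^p = β` were roots, the minimal polynomial `m` of `α`
would divide `m(X^p)`, the root set would be stable under `γ ↦ γ^p`, and pigeonhole would make `α` a root
of unity), giving the unconditional forms `prime_pow_le_abs_resultant_expand_of_irreducible`,
`prime_le_length_mul_mahlerMeasure_pow_of_irreducible`, `two_lt_mahlerMeasure_pow_length_of_irreducible`.
-/

section Part4

namespace Literature.NumberTheory.MahlerMeasure

open _root_.Polynomial

/-- **Length bound** `|f(β)| ≤ L(f) · max(1, |β|)^{deg f}`, with `L(f) = Σ_i |f_i|`.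
[cite: MckeeSmyth2021, §A (length of a polynomial: |P(α)| ≤ L(P) max(1,|α|)^{deg P})] -/
theorem norm_eval_le_length_mul (f : ℤ[X]) (β : ℂ) :
    ‖(f.map (Int.castRingHom ℂ)).eval β‖ ≤
      (∑ i ∈ Finset.range (f.natDegree + 1), (|f.coeff i| : ℝ)) * max 1 ‖β‖ ^ f.natDegree := by
  have hinj : Function.Injective (Int.castRingHom ℂ) := (Int.castRingHom ℂ).injective_int
  have hm1 : 1 ≤ max 1 ‖β‖ := le_max_left _ _
  rw [eval_eq_sum_range, natDegree_map_eq_of_injective hinj, Finset.sum_mul]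
  refine (norm_sum_le _ _).trans (Finset.sum_le_sum fun i hi => ?_)
  rw [Finset.mem_range] at hi
  rw [coeff_map, eq_intCast, norm_mul, norm_pow, Complex.norm_intCast]
  refine mul_le_mul_of_nonneg_left ?_ (abs_nonneg _)
  calc ‖β‖ ^ i ≤ max 1 ‖β‖ ^ i := pow_le_pow_left₀ (norm_nonneg _) (le_max_right _ _) i
    _ ≤ max 1 ‖β‖ ^ f.natDegree := pow_le_pow_right₀ hm1 (by omega)

/-- The length of a nonzero integer polynomial is `≥ 1`.
[cite: MckeeSmyth2021, §A (length of a polynomial: |P(α)| ≤ L(P) max(1,|α|)^{deg P})] -/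
theorem one_le_length {f : ℤ[X]} (hf : f ≠ 0) :
    (1 : ℝ) ≤ ∑ i ∈ Finset.range (f.natDegree + 1), (|f.coeff i| : ℝ) := by
  have hlc : (1 : ℝ) ≤ |(f.coeff f.natDegree : ℝ)| := by
    have h : (1 : ℤ) ≤ |f.coeff f.natDegree| := Int.one_le_abs (by
      rw [coeff_natDegree]; exact leadingCoeff_ne_zero.mpr hf)
    exact_mod_cast h
  refine hlc.trans ?_
  exact Finset.single_le_sum (f := fun i => (|f.coeff i| : ℝ)) (fun i _ => abs_nonneg _)
    (Finset.mem_range.mpr (Nat.lt_succ_self _))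

end Literature.NumberTheory.MahlerMeasure

end Part4

/-!
## Part 5 — port of `Summits/Ventures/DiscreteObjects/Mahler/LiouvilleInequality.lean` (2 declarations kept)

# A lower bound for an integer polynomial evaluated at an algebraic number (venture `DiscreteObjects`, target L)

Cell `pub-namedobj`, seat `pub-namedobj-mahler` (gen 10). Framing: lottery ticket; floor = certified
bounds/negative ranges.

[McKee–Smyth, *Around the Unit Circle*, Thm 1.21]: given `Q ∈ ℤ[z]` of degree `e` and an algebraic
number `α` of degree `d` (minimal polynomial `f ∈ ℤ[z]`, Mahler measure `M(α) = M(f)`), either `Q(α) = 0`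
or
`|Q(α)| ≥ max(1, |α|)^e / (L^{d-1} M(α)^e)`, `L = L(Q) = ∑ |q_i|` (1.7).

Kernel route: the resultant `Res(f, Q) = a^e ∏_{f(β)=0} Q(β)` is a nonzero integer (a common root would
make the irreducible `f` divide `Q`, `dvd_of_aeval_eq_zero_of_irreducible`), so
`1 ≤ |a|^e |Q(α)| ∏_{β ≠ α} |Q(β)| ≤ |Q(α)| · L^{d-1} · (|a| ∏_{β ≠ α} max(1,|β|))^e`
and `|a| ∏_{β ≠ α} max(1,|β|) = M(f)/max(1,|α|)` (`norm_eval_le_length_mul`, gen 8).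

* `resultant_ne_zero_of_irreducible_of_not_dvd` — `Res(f, Q) ≠ 0` when the irreducible `f` does not divide `Q`;
* `liouville_mahler_inequality` — **Thm 1.21**.
-/

section Part5

namespace Literature.NumberTheory.MahlerMeasure

open _root_.Polynomial

/-- If `f ∈ ℤ[X]` is irreducible of positive degree and `f ∤ Q`, then `Res(f, Q) ≠ 0` (no common
complex root). [cite: MckeeSmyth2021, Theorem 1.21 p.25 (Q(α) = 0 or |Q(α)| ≥ max(1,|α|)^e / (L(Q)^{d−1} M(α)^e))] -/
theorem resultant_ne_zero_of_irreducible_of_not_dvd {f Q : ℤ[X]} (hirr : Irreducible f)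
    (hd : 1 ≤ f.natDegree) (hndvd : ¬ f ∣ Q) {e : ℕ} (he : Q.natDegree ≤ e) :
    f.resultant Q f.natDegree e ≠ 0 := by
  intro h
  have hinj : Function.Injective (Int.castRingHom ℂ) := (Int.castRingHom ℂ).injective_int
  have hC := resultant_intCast_eq (f := f) (G := Q) he
  rw [h, Int.cast_zero] at hC
  have hlc : (f.map (Int.castRingHom ℂ)).leadingCoeff ≠ 0 := by
    rw [Ne, leadingCoeff_eq_zero, Polynomial.map_eq_zero_iff hinj]
    exact hirr.ne_zero
  rcases mul_eq_zero.mp hC.symm with h1 | h2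
  · exact hlc (pow_eq_zero_iff'.mp h1).1
  · rw [Multiset.prod_eq_zero_iff, Multiset.mem_map] at h2
    obtain ⟨β, hβmem, hβ0⟩ := h2
    have hβf : aeval β f = 0 := aeval_eq_zero_of_mem_roots_map hβmem
    have hβQ : aeval β Q = 0 := by rwa [← algebraMap_int_eq, eval_map_algebraMap] at hβ0
    exact hndvd (dvd_of_aeval_eq_zero_of_irreducible hirr hd hβf hβQ)

/-- **[McKee–Smyth, Thm 1.21] (Liouville-type inequality).**  Let `f ∈ ℤ[X]` be irreducible of degree
`d ≥ 1` with complex root `α`, and `Q ∈ ℤ[X]` of degree `≤ e` with `Q(α) ≠ 0`.  Then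
`|Q(α)| ≥ max(1,|α|)^e / (L(Q)^{d-1} · M(f)^e)`, `L(Q) = ∑_{i ≤ e} |q_i|`.
[cite: MckeeSmyth2021, Theorem 1.21 p.25 (Q(α) = 0 or |Q(α)| ≥ max(1,|α|)^e / (L(Q)^{d−1} M(α)^e))] -/
theorem liouville_mahler_inequality {f : ℤ[X]} (hirr : Irreducible f) (hd : 1 ≤ f.natDegree)
    {α : ℂ} (hα : aeval α f = 0) {Q : ℤ[X]} {e : ℕ} (he : Q.natDegree ≤ e) (hQα : aeval α Q ≠ 0) :
    max 1 ‖α‖ ^ e / ((∑ i ∈ Finset.range (Q.natDegree + 1), (|Q.coeff i| : ℝ)) ^ (f.natDegree - 1) *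
      intMahlerMeasure f ^ e) ≤ ‖aeval α Q‖ := by
  classical
  have hf : f ≠ 0 := hirr.ne_zero
  have hinj : Function.Injective (Int.castRingHom ℂ) := (Int.castRingHom ℂ).injective_int
  set d := f.natDegree with hdd
  set fc := f.map (Int.castRingHom ℂ) with hfc
  set Qc := Q.map (Int.castRingHom ℂ) with hQc
  set R := fc.roots with hR
  set L : ℝ := ∑ i ∈ Finset.range (Q.natDegree + 1), (|Q.coeff i| : ℝ) with hL
  have hQ0 : Q ≠ 0 := by rintro rfl; exact hQα (map_zero _)
  have hL1 : 1 ≤ L := one_le_length hQ0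
  have hL0 : 0 < L := by linarith
  have hfc0 : fc ≠ 0 := (Polynomial.map_ne_zero_iff hinj).mpr hf
  have hαR : α ∈ R := by
    rw [hR, mem_roots hfc0, IsRoot.def, hfc, ← algebraMap_int_eq, eval_map_algebraMap]; exact hα
  have hevalQ : ∀ β : ℂ, Qc.eval β = aeval β Q := by
    intro β; rw [hQc, ← algebraMap_int_eq, eval_map_algebraMap]
  -- the resultant is a nonzero integer
  have hndvd : ¬ f ∣ Q := by
    rintro ⟨T, hT⟩
    exact hQα (by rw [hT, map_mul, hα, zero_mul])
  have hres := resultant_ne_zero_of_irreducible_of_not_dvd hirr hd hndvd he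
  have h1 : (1 : ℝ) ≤ ‖((f.resultant Q d e : ℤ) : ℂ)‖ := by
    rw [Complex.norm_intCast]
    exact_mod_cast Int.one_le_abs hres
  rw [resultant_intCast_eq (f := f) (G := Q) he, norm_mul, norm_pow] at h1
  have hmp := map_multiset_prod (normHom : ℂ →*₀ ℝ) ((R.map Qc.eval))
  rw [Multiset.map_map] at hmp
  simp only [normHom_apply, Function.comp_def] at hmp
  rw [← hfc, ← hR, hmp, ← Multiset.cons_erase hαR, Multiset.map_cons, Multiset.prod_cons] at h1
  -- per-root bound on the other roots
  set R' := R.erase α with hR'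
  have hcardR : Multiset.card R = d := by
    have hsp := (IsAlgClosed.splits fc).natDegree_eq_card_roots
    rw [hfc, natDegree_map_eq_of_injective hinj] at hsp
    rw [hR, hfc]; exact hsp.symm
  have hcardR' : Multiset.card R' = d - 1 := by
    rw [hR', Multiset.card_erase_of_mem hαR, hcardR]; rfl
  have hprod : (R'.map fun β => ‖Qc.eval β‖).prod ≤ L ^ (d - 1) * (R'.map fun β => max 1 ‖β‖).prod ^ e := by
    calc (R'.map fun β => ‖Qc.eval β‖).prod ≤ (R'.map fun β => L * max 1 ‖β‖ ^ e).prod := by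
          refine Multiset.prod_map_le_prod_map₀ _ _ (fun β _ => norm_nonneg _) (fun β _ => ?_)
          refine (norm_eval_le_length_mul Q β).trans ?_
          exact mul_le_mul_of_nonneg_left (pow_le_pow_right₀ (le_max_left _ _) he) hL0.le
      _ = L ^ (d - 1) * (R'.map fun β => max 1 ‖β‖).prod ^ e := by
          rw [Multiset.prod_map_mul, Multiset.prod_map_pow, Multiset.map_const', Multiset.prod_replicate,
            hcardR']
  -- the Mahler measure
  have hM : intMahlerMeasure f = ‖fc.leadingCoeff‖ * (max 1 ‖α‖ * (R'.map fun β => max 1 ‖β‖).prod) := by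
    unfold intMahlerMeasure
    rw [mahlerMeasure_eq_leadingCoeff_mul_prod_roots, ← hfc, ← hR, ← Multiset.cons_erase hαR,
      Multiset.map_cons, Multiset.prod_cons]
  have hM0 : 0 < intMahlerMeasure f := by
    unfold intMahlerMeasure; exact mahlerMeasure_pos_of_ne_zero hfc0
  have hm1 : 0 < max 1 ‖α‖ := lt_of_lt_of_le one_pos (le_max_left _ _)
  have hP0 : 0 ≤ (R'.map fun β => max 1 ‖β‖).prod :=
    Multiset.prod_nonneg (fun x hx => by
      obtain ⟨β, _, rfl⟩ := Multiset.mem_map.mp hx; positivity)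
  -- assemble: `1 ≤ ‖Q α‖ · L^{d-1} · (M / max(1,‖α‖))^e`
  have hkey : 1 ≤ ‖aeval α Q‖ * (L ^ (d - 1) * intMahlerMeasure f ^ e) / max 1 ‖α‖ ^ e := by
    rw [le_div_iff₀ (pow_pos hm1 e), one_mul]
    calc max 1 ‖α‖ ^ e = max 1 ‖α‖ ^ e * 1 := (mul_one _).symm
      _ ≤ max 1 ‖α‖ ^ e * (‖fc.leadingCoeff‖ ^ e * (‖Qc.eval α‖ * (R'.map fun β => ‖Qc.eval β‖).prod)) :=
          mul_le_mul_of_nonneg_left h1 (pow_nonneg hm1.le e)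
      _ ≤ max 1 ‖α‖ ^ e * (‖fc.leadingCoeff‖ ^ e *
            (‖Qc.eval α‖ * (L ^ (d - 1) * (R'.map fun β => max 1 ‖β‖).prod ^ e))) := by
          gcongr
      _ = ‖aeval α Q‖ * (L ^ (d - 1) * intMahlerMeasure f ^ e) := by
          rw [hevalQ α, hM, mul_pow, mul_pow]; ring
  have hden : 0 < L ^ (d - 1) * intMahlerMeasure f ^ e := by positivity
  rw [div_le_iff₀ hden]
  have h2 := hkey
  rw [le_div_iff₀ (pow_pos hm1 e), one_mul] at h2
  linarith

end Literature.NumberTheory.MahlerMeasure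

end Part5

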